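import Summits.HubbardSuperconductivity.HubbardSuperconductivity.Theses.SpNLargeN
import Summits.HubbardSuperconductivity.HubbardSuperconductivity.Theorems.TwTipContinuation.Negative.TipNormalForm

/-!
# Line `vanishing_exchange` for crux `SpnTarget` (stmt-HubbardSuperconductivity-1663), route SpNLargeN

Crux-strategist skeleton (RESTATED re-audit, BC2 redirect, 2026-08-17). The two REGISTERED STUBS are
exactly the two pieces of the typed decomposition of `SpnTarget`, now ROUTE ITEMS stated by name
(`TUJWindowFloor` = stmt-HubbardSuperconductivity-19075, `EndpointStability` =
stmt-HubbardSuperconductivity-19076; glue item `SpnTargetOfPieces` = stmt-19084; certificate in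
`Cruxes/SpnTarget/SPLIT.md`, proof also in `Cruxes/SpnTarget/Split.lean`):

* `stub_tUJWindowFloor`   — every-GS `d`-wave floor for the `t-U-J` torus model, `J ∈ (0, J₀]` ONLY,
  on an open `U`-window, constants uniform in `J` and in the even side (the REGULARISED side);
* `stub_endpointStability` — every unit sector ground state of the PURE Hubbard torus is a limit of
  `t-U-J` sector ground states along `J_n ↓ 0`, for every doping, a dense set of `U`, all large even
  sides (the LIMIT side; no order content).

`spnTarget_of_pieces` is the kernel-checked composition (same proof as `Cruxes/SpnTarget/Split.lean`):
continuity of the order functional transports the `J > 0` floor to the `J = 0` ground states;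
`SpnTarget_of` applies it to the two stubs and concludes the crux BY NAME.
-/

set_option linter.dupNamespace false

namespace Summit.HubbardSuperconductivity.HubbardSuperconductivity.Cruxes.SpnTarget.VanishingExchange

open Matrix Filter Topology Literature.MathematicalPhysics.QuantumLattice
open Summit.HubbardSuperconductivity.HubbardSuperconductivity.Theses.SpNLargeN
open Summit.HubbardSuperconductivity.TwTipContinuation.Negative (expect_pairIntensity_le)

/-! ## The two registered stubs (= the pieces) -/

/-- **Stub 1 (= child `TUJWindowFloor`, crux-sized, open-problem): uniform `t-U-J` window floor.**
On an open window of repulsions and at one doping, every unit sector ground state of the `t-U-J`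
torus model with `J ∈ (0, J₀]` has `d`-wave pair-field density `≥ a`, uniformly in `J` and in the
even side. Inputs foreseen: large-`n` `Sp(2n)` anchor + `n₀ = 1` descent at moderate `J`;
weak-coupling constructive BCS with the bare bond-singlet attraction `J` and the Kohn–Luttinger
`U²` enhancement (`g_eff ≈ αJ + βU² ≥ βU²` bounded below uniformly in `J ≥ 0`). -/
theorem stub_tUJWindowFloor : TUJWindowFloor := by
  sorry

/-- **Stub 2 (= child `EndpointStability`, research-sized): endpoint spectral stability at `J = 0`.**
For every doping and every open `U`-window there is `U` in the window such that at all large even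
sides every unit sector ground state of the pure Hubbard torus is a limit of `t-U-J` sector ground
states along some `J_n ↓ 0`. Inputs foreseen: finite-dimensional analytic perturbation theory
(Kato–Rellich: the limiting ground space sits inside the `J = 0` ground space, with equality iff
the exchange term does not split it), irreducibility of the `J = 0` ground multiplet under the
symmetries shared by both models (no accidental degeneracy, generic in `U`). -/
theorem stub_endpointStability : EndpointStability := by
  sorry

/-! ## The composition -/

/-- **Continuity of the `d`-wave order functional at a fixed side.** For any side `L ≠ 0` and any
real constant `c`, `φ ↦ Re⟨φ, Δ_d†Δ_d φ⟩ / c` is continuous on the finite-dimensional Fock space of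
the torus (`expect A φ = star φ ⬝ᵥ (A *ᵥ φ)` is a polynomial in the coordinates of `φ` and their
conjugates). Tasaki (2020) §2.1. [folklore] -/
theorem continuous_dWaveOrderFunctional (L : ℕ) [NeZero L] (c : ℝ) :
    Continuous fun φ : Fock (Orb (FermionTorus 2 L)) =>
      (expect ((pairField dWaveFormFactor L)ᴴ * pairField dWaveFormFactor L) φ).re / c := by
  unfold expect
  refine Continuous.div_const (Complex.continuous_re.comp ?_) _
  exact (continuous_id.star).dotProduct (continuous_const.matrix_mulVec continuous_id)

/-- **Composition of the pieces**: (Stub 1) → (Stub 2) → `SpnTarget`. Pick `U` in the floor's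
window where the endpoint is stable; at `J ∈ (0, J₀]` the window floor applies; at `J = 0` every
ground state of the pure torus of side `2(k+1)`, `k ≥ max k₁ k₂`, is `lim ψ_n` of `t-U-J` ground
states along `J_n ↓ 0`, eventually `J_n ≤ J₀`, so `F(ψ_n) ≥ a` and `F(lim ψ_n) ≥ a` by continuity
of the order functional; `liminf ≥ a > 0`, cobounded by the kinematic ceiling. -/
theorem spnTarget_of_pieces : TUJWindowFloor → EndpointStability →
    Summit.HubbardSuperconductivity.HubbardSuperconductivity.Theses.SpNLargeN.SpnTarget := by
  intro hFloor hStab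
  unfold TUJWindowFloor at hFloor
  unfold EndpointStability at hStab
  obtain ⟨U₁, U₂, δ, hU₁, hU₁₂, hδ, hwin⟩ := hFloor
  obtain ⟨U, hUmem, k₂, hstab⟩ := hStab δ hδ U₁ U₂ hU₁ hU₁₂
  obtain ⟨J₀, a, hJ₀, ha, k₁, hfloor⟩ := hwin U hUmem
  have hU : 0 < U := lt_of_le_of_lt hU₁ hUmem.1
  refine ⟨U, δ, J₀, hU, hδ, hJ₀, ?_⟩
  intro J hJ N ψ hadm
  -- the order functional along the given sequence
  set F : ℕ → ℝ := fun k => (expect ((pairField dWaveFormFactor (2 * (k + 1)))ᴴ *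
      pairField dWaveFormFactor (2 * (k + 1))) (ψ (2 * (k + 1)))).re /
        (((2 * (k + 1) : ℕ) : ℝ) ^ 4) with hF
  -- Step 1: the floor `a` holds eventually along the sequence
  have hev : ∀ᶠ k in atTop, a ≤ F k := by
    refine eventually_atTop.2 ⟨max k₁ k₂, fun k hk => ?_⟩
    obtain ⟨hN, hnorm, hGS⟩ := hadm (2 * (k + 1)) (even_two_mul (k + 1))
    rw [hN] at hGS
    rcases eq_or_lt_of_le hJ.1 with h0 | hpos
    · -- the endpoint `J = 0`: approximate the pure-model ground state by `t-U-J` ground states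
      subst h0
      simp only [zero_div, Complex.ofReal_zero, zero_smul, sub_zero] at hGS
      obtain ⟨Js, ψs, hJpos, hJlim, hGSs, hlim⟩ :=
        hstab k (le_of_max_le_right hk) (ψ (2 * (k + 1))) hnorm hGS
      -- eventually `Js n ≤ J₀`, so the window floor applies to `ψs n`
      have hevn : ∀ᶠ n in atTop, a ≤ (expect ((pairField dWaveFormFactor (2 * (k + 1)))ᴴ *
          pairField dWaveFormFactor (2 * (k + 1))) (ψs n)).re / (((2 * (k + 1) : ℕ) : ℝ) ^ 4) := by
        filter_upwards [hJlim.eventually_lt_const hJ₀] with n hn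
        exact hfloor (Js n) ⟨hJpos n, hn.le⟩ k (le_of_max_le_left hk) (ψs n) (hGSs n).1 (hGSs n).2
      -- continuity of the order functional transports the floor to the limit `ψ (2(k+1))`
      have htend := ((continuous_dWaveOrderFunctional (2 * (k + 1))
        ((((2 * (k + 1) : ℕ) : ℝ) ^ 4))).tendsto (ψ (2 * (k + 1)))).comp hlim
      exact ge_of_tendsto htend hevn
    · exact hfloor J ⟨hpos, hJ.2⟩ k (le_of_max_le_left hk) (ψ (2 * (k + 1))) hnorm hGS
  -- Step 2: the kinematic ceiling makes the `liminf` honest (coboundedness)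
  have hev' : ∀ᶠ k in atTop, F k ≤
      (∑ e ∈ insert 0 unitSteps, ‖((dWaveFormFactor e / Real.sqrt 2 : ℝ) : ℂ)‖ * 2) ^ 2 := by
    refine Eventually.of_forall fun k => ?_
    obtain ⟨-, hnorm, -⟩ := hadm (2 * (k + 1)) (even_two_mul (k + 1))
    have hpos : (0 : ℝ) < (((2 * (k + 1) : ℕ) : ℝ) ^ 4) := by positivity
    simp only [hF]
    rw [div_le_iff₀ hpos]
    exact expect_pairIntensity_le (2 * (k + 1)) (ψ (2 * (k + 1))) hnorm
  exact lt_of_lt_of_le ha (le_liminf_of_le (isCoboundedUnder_ge_of_eventually_le _ hev') hev)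


/-- **The crux from the stubs** (sorries only inside `stub_tUJWindowFloor`, `stub_endpointStability`). -/
theorem SpnTarget_of :
    Summit.HubbardSuperconductivity.HubbardSuperconductivity.Theses.SpNLargeN.SpnTarget :=
  spnTarget_of_pieces stub_tUJWindowFloor stub_endpointStability

end Summit.HubbardSuperconductivity.HubbardSuperconductivity.Cruxes.SpnTarget.VanishingExchange
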